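import Summits.QuantumFields.QCD.Theses.PauliWegnerSea
import Summits.QuantumFields.QCD.Theses.WilsonMobilityGap
import Summits.QuantumFields.QCD.Theorems.MobilityGap.Negative.LowerPin

/-!
# `PauliWegnerSea.OneScaleTrajectory` (stmt-QuantumFields-11513): the one-scale input is clause (ii)
# of `MobilityGap` read on ONE log-scale shell — available whenever the physical volume is
# superlogarithmic

Support file (prover, item-scoped), pure real analysis on top of the clause abbreviations of
`Theorems/MobilityGap/Negative/LowerPin.lean` (`bare`, `fm`, `ClauseI`, `Upper`, `Lower`, `Sign`,
`Clauses`).  No new definitions.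

* `eventually_one_add_abs_beta_le_div` — two-loop asymptotic scaling bounds the coupling by the
  cutoff: `1 + |β_k| ≤ M / a_k` eventually (`afBeta` is logarithmic in `1/a_k`).
* `oneScale_of_upper` — for ONE regularisation `reg` and mass tuple `m`: if `reg` scales
  asymptotically, its physical volume is superlogarithmic, `a_k L_k / (1 + |log a_k|) → ∞`, and the
  phase-quenched fractional moment obeys clause (ii) UPPER of `MobilityGap`
  (`fm ≤ C e^{-δ a_k ‖v‖}` on every torus `S ≥ L_k`), then the ONE-SCALE input of
  `OneScaleTrajectory` / `FMClosureUnquenched` holds for `(reg, m)`: for every `q` take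
  `K₀ = (3q+1)/δ` and the shell `ℓ₀ = ⌊K₀ (1+|log a_k|)/a_k⌋`; there (ii) gives
  `fm ≤ C e^{δ} a_k^{3q+1}`, while `ℓ₀^q (1+|β_k|)^q ≤ (2K₀)^q M^q a_k^{-3q}`, and `const · a_k → 0`.
  (The volume hypothesis is exactly what puts the shell inside the torus, `ℓ₀ ≤ L_k`.)
* `oneScaleTrajectory_of_clauses_superlog`, `chiralOneScaleTrajectory_of_clauses_superlog` — hence a
  `MobilityGap`-witness (clause package `Clauses N_f reg` of the sibling route `WilsonMobilityGap`)
  with superlogarithmic volume is a witness of `OneScaleTrajectory`, and a chiral one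
  (`reg.IsChiralAtZero`) is a witness of the live crux `ChiralOneScaleTrajectory`
  (stmt-QuantumFields-17512).  Together with the tree's converse bookkeeping
  `mobilityGap_of_pauliWegnerSea_cruxes` (K1 ∧ K2 turn the one-scale input back into (ii)), this
  places the trajectory items of the two sibling routes on one line: they differ only by clause
  (ii) ↔ its one-shell trace, modulo `a_k L_k ≫ log(1/a_k)`.
-/

noncomputable section

namespace Summit.QuantumFields.QCD.Theorems.OneScaleTrajectoryContent

open scoped BigOperators Topology
open MeasureTheory Filter Set
open Literature.MathematicalPhysics.QuantumFieldTheory Literature.MathematicalPhysics.QuantumLattice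
  Literature.Probability.LatticeModels
open Summit.QuantumFields.QCD.Theorems.MobilityGapNegative
open Summit.QuantumFields.QCD.Theses.PauliWegnerSea (OneScaleTrajectory ChiralOneScaleTrajectory)

variable {Nf : ℕ}

/-- The two-loop profile is at most a multiple of the cutoff: for `0 < a`, `a Λ ≤ 1/2`,
`|afBeta N_f Λ a| ≤ (2|b₀| + 2|b₁/b₀|) · 2/(a Λ)` (`ℓ = log (1/(a²Λ²)) = 2|log (aΛ)| < 2/(aΛ)`,
`1 ≤ ℓ`, `0 ≤ log ℓ ≤ ℓ`). -/
theorem abs_afBeta_le (Nf : ℕ) {Λ a : ℝ} (hΛ : 0 < Λ) (ha : 0 < a) (haΛ : a * Λ ≤ 1 / 2) :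
    |afBeta Nf Λ a| ≤ (2 * |betaCoeff₀ Nf| + 2 * |betaCoeff₁ Nf / betaCoeff₀ Nf|) * (2 / (a * Λ)) := by
  have hx : 0 < a * Λ := mul_pos ha hΛ
  have hx1 : a * Λ ≤ 1 := haΛ.trans (by norm_num)
  set ℓ : ℝ := Real.log (1 / (a ^ 2 * Λ ^ 2)) with hℓ
  have hℓeq : ℓ = -2 * Real.log (a * Λ) := by
    rw [hℓ, show a ^ 2 * Λ ^ 2 = (a * Λ) ^ 2 by ring, one_div, Real.log_inv, Real.log_pow]
    push_cast
    ring
  have hlogneg : Real.log (a * Λ) ≤ 0 := Real.log_nonpos hx.le hx1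
  have hℓabs : ℓ = 2 * |Real.log (a * Λ)| := by rw [hℓeq, abs_of_nonpos hlogneg]; ring
  -- `|log x| x < 1` for `0 < x ≤ 1`
  have hlt : |Real.log (a * Λ)| < 1 / (a * Λ) := by
    have h := Real.abs_log_mul_self_lt (a * Λ) hx hx1
    rw [abs_mul, abs_of_pos hx] at h
    rwa [lt_div_iff₀ hx]
  have hℓle : ℓ ≤ 2 / (a * Λ) := by
    rw [hℓabs, div_eq_mul_one_div]
    linarith
  -- `1 ≤ ℓ`: `1/(a²Λ²) ≥ 4 ≥ e`
  have harg : 4 ≤ 1 / (a ^ 2 * Λ ^ 2) := by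
    rw [show a ^ 2 * Λ ^ 2 = (a * Λ) ^ 2 by ring, le_div_iff₀ (by positivity)]
    nlinarith
  have hℓ1 : 1 ≤ ℓ := by
    have h := Real.log_le_log (Real.exp_pos 1)
      (show Real.exp 1 ≤ 1 / (a ^ 2 * Λ ^ 2) by linarith [Real.exp_one_lt_three])
    rwa [Real.log_exp] at h
  have hℓpos : 0 < ℓ := by linarith
  have hlog0 : 0 ≤ Real.log ℓ := Real.log_nonneg hℓ1
  have hlogℓ : Real.log ℓ ≤ ℓ := (Real.log_le_sub_one_of_pos hℓpos).trans (by linarith)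
  unfold afBeta
  rw [← hℓ]
  refine (abs_add_le _ _).trans ?_
  rw [abs_mul, abs_mul, abs_mul, abs_mul, abs_of_pos hℓpos, abs_of_nonneg hlog0,
    abs_of_pos (two_pos : (0 : ℝ) < 2)]
  have h1 : 2 * |betaCoeff₀ Nf| * ℓ ≤ 2 * |betaCoeff₀ Nf| * (2 / (a * Λ)) :=
    mul_le_mul_of_nonneg_left hℓle (by positivity)
  have h2 : 2 * |betaCoeff₁ Nf / betaCoeff₀ Nf| * Real.log ℓ ≤
      2 * |betaCoeff₁ Nf / betaCoeff₀ Nf| * (2 / (a * Λ)) :=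
    mul_le_mul_of_nonneg_left (hlogℓ.trans hℓle) (by positivity)
  linarith

/-- **Asymptotic scaling bounds the coupling by the cutoff.** Along a regularisation whose scheme
scales asymptotically there is `M > 0` with `1 + |β_k| ≤ M / a_k` eventually. -/
theorem eventually_one_add_abs_beta_le_div (reg : QCDRegularisation Nf)
    (hAS : (reg.scheme 0 0 0).HasAsymptoticScaling) :
    ∃ M : ℝ, 0 < M ∧ ∀ᶠ k in atTop, 1 + |reg.β k| ≤ M / reg.a k := by
  obtain ⟨Λ, hΛ, hε⟩ := hAS
  set Cβ : ℝ := 2 * |betaCoeff₀ Nf| + 2 * |betaCoeff₁ Nf / betaCoeff₀ Nf| with hCβ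
  have hCβ0 : 0 ≤ Cβ := by positivity
  refine ⟨2 + 2 * Cβ / Λ, by positivity, ?_⟩
  have hε' : ∀ᶠ k in atTop, |reg.β k - afBeta Nf Λ (reg.a k)| < 1 := by
    have h := (Metric.tendsto_nhds.1 hε) 1 one_pos
    filter_upwards [h] with k hk
    rwa [Real.dist_0_eq_abs] at hk
  have ha1 : ∀ᶠ k in atTop, reg.a k ≤ 1 := reg.tendsto_a.eventually (eventually_le_nhds one_pos)
  have haΛ : ∀ᶠ k in atTop, reg.a k * Λ ≤ 1 / 2 := by
    have h : Tendsto (fun k => reg.a k * Λ) atTop (𝓝 (0 * Λ)) := reg.tendsto_a.mul_const Λ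
    rw [zero_mul] at h
    exact h.eventually (eventually_le_nhds (by norm_num))
  filter_upwards [hε', ha1, haΛ] with k hk ha1k haΛk
  have ha := reg.a_pos k
  have haf := abs_afBeta_le Nf hΛ ha haΛk
  have hβ : |reg.β k| ≤ 1 + Cβ * (2 / (reg.a k * Λ)) := by
    have h1 : |reg.β k| ≤ |reg.β k - afBeta Nf Λ (reg.a k)| + |afBeta Nf Λ (reg.a k)| := by
      have := abs_add_le (reg.β k - afBeta Nf Λ (reg.a k)) (afBeta Nf Λ (reg.a k))
      rwa [sub_add_cancel] at this
    linarith
  have h2a : (2 : ℝ) ≤ 2 / reg.a k := by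
    rw [le_div_iff₀ ha]; nlinarith
  have e : Cβ * (2 / (reg.a k * Λ)) = 2 * Cβ / Λ / reg.a k := by
    field_simp
  rw [e] at hβ
  have : (2 + 2 * Cβ / Λ) / reg.a k = 2 / reg.a k + 2 * Cβ / Λ / reg.a k := by ring
  rw [this]
  linarith

/-- `1 + |log a| ≤ 2 / a` for `0 < a ≤ 1` (`|log a| a < 1`). -/
theorem one_add_abs_log_le {a : ℝ} (ha : 0 < a) (ha1 : a ≤ 1) : 1 + |Real.log a| ≤ 2 / a := by
  have h := Real.abs_log_mul_self_lt a ha ha1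
  rw [abs_mul, abs_of_pos ha, ← lt_div_iff₀ ha] at h
  have h1 : (1 : ℝ) ≤ 1 / a := by rw [le_div_iff₀ ha]; linarith
  have : (2 : ℝ) / a = 1 / a + 1 / a := by ring
  linarith

/-- **Clause (ii) on a superlogarithmic volume gives the one-scale input.** For one regularisation
`reg` with asymptotic scaling and `a_k L_k / (1 + |log a_k|) → ∞`, and one mass tuple `m`: the UPPER
clause (ii) of `MobilityGap` for `(reg, m)` implies the one-scale input of `OneScaleTrajectory` for
`(reg, m)` — for every `q`, with `K₀ = (3q+1)/δ`, the same exponent `s`, and the shell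
`ℓ₀ = ⌊K₀ (1+|log a_k|)/a_k⌋ ≤ L_k`. -/
theorem oneScale_of_upper (reg : QCDRegularisation Nf) (m : Fin Nf → ℝ)
    (hAS : (reg.scheme 0 0 0).HasAsymptoticScaling)
    (hvol : Tendsto (fun k => reg.a k * reg.L k / (1 + |Real.log (reg.a k)|)) atTop atTop)
    (hU : Upper reg m) :
    ∀ q : ℕ, ∃ K₀ s : ℝ, 0 < s ∧ s < 1 ∧ ∀ᶠ k in atTop, ∃ ℓ₀ : ℕ, 1 ≤ ℓ₀ ∧ ℓ₀ ≤ reg.L k ∧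
      (ℓ₀ : ℝ) * reg.a k ≤ K₀ * (1 + |Real.log (reg.a k)|) ∧ ∀ S : ℕ, reg.L k ≤ S →
        ∀ (f : Fin Nf) (v : Site 4), v ∈ box 4 S → ‖v‖ = (ℓ₀ : ℝ) →
          (ℓ₀ : ℝ) ^ q * (1 + |reg.β k|) ^ q * fm Nf (reg.β k) (bare reg m k) S f v s ≤ 1 := by
  intro q
  obtain ⟨s, δ, C, hs, hs1, hδ, hU⟩ := hU
  obtain ⟨M, hM, hβ⟩ := eventually_one_add_abs_beta_le_div reg hAS
  set K₀ : ℝ := ((3 * q + 1 : ℕ) : ℝ) / δ with hK₀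
  have hK₀pos : 0 < K₀ := by positivity
  have hδK₀ : δ * K₀ = ((3 * q + 1 : ℕ) : ℝ) := by rw [hK₀]; field_simp
  refine ⟨K₀, s, hs, hs1, ?_⟩
  -- the constant of the final race `Const · a_k ≤ 1`
  set Const : ℝ := (2 * K₀) ^ q * M ^ q * (C * Real.exp δ) with hConst
  have ha1 : ∀ᶠ k in atTop, reg.a k ≤ 1 := reg.tendsto_a.eventually (eventually_le_nhds one_pos)
  have haK : ∀ᶠ k in atTop, reg.a k ≤ K₀ := reg.tendsto_a.eventually (eventually_le_nhds hK₀pos)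
  have hrace : ∀ᶠ k in atTop, Const * reg.a k ≤ 1 := by
    have h : Tendsto (fun k => Const * reg.a k) atTop (𝓝 (Const * 0)) :=
      reg.tendsto_a.const_mul Const
    rw [mul_zero] at h
    exact h.eventually (eventually_le_nhds one_pos)
  have hvolK : ∀ᶠ k in atTop, K₀ ≤ reg.a k * reg.L k / (1 + |Real.log (reg.a k)|) :=
    hvol.eventually_ge_atTop K₀
  filter_upwards [hU, hβ, ha1, haK, hrace, hvolK] with k hUk hβk ha1k haKk hracek hvolk
  have ha := reg.a_pos k
  have hlog0 : 0 < 1 + |Real.log (reg.a k)| := by positivity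
  -- the shell
  set x : ℝ := K₀ * (1 + |Real.log (reg.a k)|) / reg.a k with hx
  have hx0 : 0 ≤ x := by positivity
  set ℓ₀ : ℕ := ⌊x⌋₊ with hℓ₀
  have hℓ₀le : (ℓ₀ : ℝ) ≤ x := Nat.floor_le hx0
  have hℓ₀ge : x - 1 ≤ (ℓ₀ : ℝ) := by linarith [Nat.lt_floor_add_one x]
  -- `1 ≤ x` since `a_k ≤ K₀`
  have hx1 : 1 ≤ x := by
    rw [hx, le_div_iff₀ ha, one_mul]
    nlinarith [mul_nonneg hK₀pos.le (abs_nonneg (Real.log (reg.a k)))]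
  refine ⟨ℓ₀, ?_, ?_, ?_, ?_⟩
  · -- `1 ≤ ℓ₀`
    exact Nat.one_le_iff_ne_zero.2 (Nat.pos_iff_ne_zero.1 (Nat.floor_pos.2 hx1))
  · -- `ℓ₀ ≤ L_k` (superlogarithmic volume)
    have h1 : x ≤ (reg.L k : ℝ) := by
      rw [hx, div_le_iff₀ ha]
      rw [le_div_iff₀ hlog0] at hvolk
      linarith
    exact_mod_cast hℓ₀le.trans h1
  · -- `ℓ₀ a_k ≤ K₀ (1 + |log a_k|)`
    exact (le_div_iff₀ ha).1 hℓ₀le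
  · intro S hS f v hv hnorm
    have hb := hUk S hS f v hv
    rw [hnorm] at hb
    have hfm0 : 0 ≤ fm Nf (reg.β k) (bare reg m k) S f v s := by
      unfold fm
      refine div_nonneg (integral_nonneg fun U => ?_) (integral_nonneg fun U => norm_nonneg _)
      exact mul_nonneg (norm_nonneg _) (Real.rpow_nonneg (by positivity) _)
    have hC0 : 0 ≤ C := by
      by_contra hC
      have hC' : C < 0 := not_le.mp hC
      have : C * Real.exp (-(δ * (reg.a k * (ℓ₀ : ℝ)))) < 0 := mul_neg_of_neg_of_pos hC' (Real.exp_pos _)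
      linarith [hfm0.trans hb]
    -- decay on the shell: `e^{-δ a_k ℓ₀} ≤ e^{δ} a_k^{3q+1}`
    have hdecay : Real.exp (-(δ * (reg.a k * (ℓ₀ : ℝ)))) ≤ Real.exp δ * reg.a k ^ (3 * q + 1) := by
      have hloga : |Real.log (reg.a k)| = -Real.log (reg.a k) :=
        abs_of_nonpos (Real.log_nonpos ha.le ha1k)
      have h2 : reg.a k * (x - 1) ≤ reg.a k * (ℓ₀ : ℝ) := mul_le_mul_of_nonneg_left hℓ₀ge ha.le
      have h3 : reg.a k * (x - 1) = K₀ * (1 + |Real.log (reg.a k)|) - reg.a k := by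
        rw [hx]; field_simp
      have hn0 : (0 : ℝ) ≤ ((3 * q + 1 : ℕ) : ℝ) := Nat.cast_nonneg _
      have h1 : -(δ * (reg.a k * (ℓ₀ : ℝ))) ≤ δ + ((3 * q + 1 : ℕ) : ℝ) * Real.log (reg.a k) := by
        have h5 : δ * (reg.a k * (x - 1)) ≤ δ * (reg.a k * (ℓ₀ : ℝ)) :=
          mul_le_mul_of_nonneg_left h2 hδ.le
        rw [h3, mul_sub, ← mul_assoc, hδK₀, hloga] at h5
        have h6 : δ * reg.a k ≤ δ := by nlinarith
        nlinarith
      calc Real.exp (-(δ * (reg.a k * (ℓ₀ : ℝ))))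
          ≤ Real.exp (δ + ((3 * q + 1 : ℕ) : ℝ) * Real.log (reg.a k)) := Real.exp_le_exp.2 h1
        _ = Real.exp δ * reg.a k ^ (3 * q + 1) := by
          rw [Real.exp_add, Real.exp_nat_mul, Real.exp_log ha]
    have hlogle : 1 + |Real.log (reg.a k)| ≤ 2 / reg.a k := one_add_abs_log_le ha ha1k
    have hℓ₀hi : (ℓ₀ : ℝ) ≤ 2 * K₀ / reg.a k ^ 2 := by
      refine hℓ₀le.trans ?_
      have h1 : x ≤ K₀ * (2 / reg.a k) / reg.a k :=
        div_le_div_of_nonneg_right (mul_le_mul_of_nonneg_left hlogle hK₀pos.le) ha.le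
      refine h1.trans (le_of_eq ?_)
      field_simp
    have hpoly1 : (ℓ₀ : ℝ) ^ q ≤ (2 * K₀ / reg.a k ^ 2) ^ q :=
      pow_le_pow_left₀ (Nat.cast_nonneg _) hℓ₀hi q
    have hpoly2 : (1 + |reg.β k|) ^ q ≤ (M / reg.a k) ^ q := pow_le_pow_left₀ (by positivity) hβk q
    have hfmle : fm Nf (reg.β k) (bare reg m k) S f v s ≤ C * (Real.exp δ * reg.a k ^ (3 * q + 1)) :=
      hb.trans (mul_le_mul_of_nonneg_left hdecay hC0)
    calc (ℓ₀ : ℝ) ^ q * (1 + |reg.β k|) ^ q * fm Nf (reg.β k) (bare reg m k) S f v s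
        ≤ (2 * K₀ / reg.a k ^ 2) ^ q * (M / reg.a k) ^ q * (C * (Real.exp δ * reg.a k ^ (3 * q + 1))) :=
          mul_le_mul (mul_le_mul hpoly1 hpoly2 (by positivity) (by positivity)) hfmle hfm0
            (by positivity)
      _ = Const * reg.a k := by
          rw [hConst, div_pow, div_pow, ← pow_mul]
          field_simp
          ring
      _ ≤ 1 := hracek

/-- **A `MobilityGap`-witness with superlogarithmic volume is a witness of `OneScaleTrajectory`.**
If for `N_f ∈ {2,3}` some regularisation carries the clause package `Clauses N_f reg` of the sibling
crux `WilsonMobilityGap.MobilityGap` (both scalings, (i)–(iv) for every positive mass tuple) and has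
`a_k L_k / (1 + |log a_k|) → ∞`, then `OneScaleTrajectory` holds (with the same witness): (ii) is
traded for its one-shell trace by `oneScale_of_upper`. -/
theorem oneScaleTrajectory_of_clauses_superlog :
    (∀ Nf : ℕ, Nf = 2 ∨ Nf = 3 → ∃ reg : QCDRegularisation Nf, Clauses Nf reg ∧
      Tendsto (fun k => reg.a k * reg.L k / (1 + |Real.log (reg.a k)|)) atTop atTop) →
    OneScaleTrajectory := by
  intro h Nf hNf
  obtain ⟨reg, ⟨hMS, hAS, hm⟩, hvol⟩ := h Nf hNf
  refine ⟨reg, hMS, hAS, fun m hmpos => ?_⟩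
  obtain ⟨h1, h2, h3, h4⟩ := hm m hmpos
  exact ⟨h1, oneScale_of_upper reg m hAS hvol h2, h3, h4⟩

/-- **... and a chiral one is a witness of the live crux `ChiralOneScaleTrajectory`**
(stmt-QuantumFields-17512): the chirality pin `reg.IsChiralAtZero` rides along unchanged. In the
vocabulary of `WilsonMobilityGapMobilityGapChiralTransfer.lean` the hypothesis is a
`ChiralMobilityGap`-witness (`reg.IsChiralAtZero ∧ Clauses N_f reg`) with superlogarithmic volume. -/
theorem chiralOneScaleTrajectory_of_clauses_superlog :
    (∀ Nf : ℕ, Nf = 2 ∨ Nf = 3 → ∃ reg : QCDRegularisation Nf,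
      (reg.IsChiralAtZero ∧ Clauses Nf reg) ∧
        Tendsto (fun k => reg.a k * reg.L k / (1 + |Real.log (reg.a k)|)) atTop atTop) →
    ChiralOneScaleTrajectory := by
  intro h Nf hNf
  obtain ⟨reg, ⟨hCh, hMS, hAS, hm⟩, hvol⟩ := h Nf hNf
  refine ⟨reg, hMS, hCh, hAS, fun m hmpos => ?_⟩
  obtain ⟨h1, h2, h3, h4⟩ := hm m hmpos
  exact ⟨h1, oneScale_of_upper reg m hAS hvol h2, h3, h4⟩

end Summit.QuantumFields.QCD.Theorems.OneScaleTrajectoryContent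

end
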